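import Literature.NumberTheory.Irrationality.Fischler2002.Theoreme32ThreeProofs
import Literature.NumberTheory.Irrationality.RhinViola2001.LevelFourPrimeDivisors
import HarnessLib

/-!
# Rhin–Viola 2001, (4.4): the transformation formula with EIGHT signs, not sixteen

Topic `Literature/NumberTheory/Irrationality/RhinViola2001`. PROOFS ONLY (no definition, no statement). G. Rhin, C. Viola, *The group
structure for ζ(3)*, Acta Arith. **97** (2001) [RhinViola2001], §4 (4.4): "the value of (4.3) `I(h,…,s)/(h!j!k!l!m!q!r!s!)` is invariant
under the action of the permutation group `Φ`" — printed, and typed in `GroupStructure.lean` (`normI_act`, PROVED as `normI_act_holds`),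
under the STANDING ASSUMPTION of §4 (p. 280): "we henceforth assume the non-negative integers (2.7) to be such that (2.8) are also
non-negative" (`Params.Admissible`: all SIXTEEN integers `≥ 0`). This file proves the formula under the weaker, natural hypothesis that
only the EIGHT parameters are non-negative AT BOTH ENDS — `P.Nonneg` and `(act ϱ P).Nonneg` (the integers (2.8) of `P`, of `ϱP` and of
the intermediate parameter vectors being free in sign; intermediate integrals may diverge): `normI_act_of_nonneg`. Route: Fischler's
Théorème 3.2 for `n = 3` (the tree's `Theoreme32.invariance_three`, seat ct-1 g34) read back through the dictionary
`Theoreme32.Jn_three_eq_lintegral_rv` — `I(P)` is Fischler's `𝒥₃` at the point `E(P) = (l, k, j ; h, s, q ; c₃ = q+h−r)` of `𝓔₃`, Rhin–Viola's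
generators are the elements `σ`, `σφσ` (= `ϕ`), `ψφσφσφσψ` (= `χ`), `φσφσψσφσφσψσφ` (= `ϑ`) of Fischler's group, the criterion is `P.Nonneg`,
and `h!j!k!l!m!q!r!s!` is Fischler's normaliser. The point `E(P)` rides on a free symbol with its defining equation. Cell `pub-zeta5`, seat
ct-1 g34, 2026-08-28. [cite: RhinViola2001, §4 (4.4), p. 280 (standing assumption)] [cite: Fischler2002Polyzetas, §3 Théorème 3.2 (n = 3)]

HONEST FRAMING (cell pub-zeta5): systematic search; no irrationality claim unless certified — an identity between convergent period
integrals and factorials; nothing about `ζ(5)` and no measure / denominator statement about `ζ(3)`.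
-/

noncomputable section

namespace Literature.NumberTheory.Irrationality.RhinViola2001

open MeasureTheory Set Fischler2002
open scoped ENNReal

section Eight

variable {E : Params → Exponents}
  (hE : ∀ P, E P = ⟨fun k => if k = 1 then P.l else if k = 2 then P.k else if k = 3 then P.j else 0,
    fun k => if k = 1 then P.h else if k = 2 then P.s else if k = 3 then P.q else 0,
    fun k => if k = 3 then P.q + P.h - P.r else 0⟩)

/-! ### The point `E(P) ∈ 𝓔₃` and the dictionary read backwards -/

include hE in
/-- `E(P) ∈ 𝓔₃` for balanced `P` ((2.3) `j+q = l+s` is `a₁+b₂ = a₃+b₃`). [cite: RhinViola2001, §2 (2.3)] [cite: Fischler2002Polyzetas, §3 p. 4 (𝓔)] -/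
theorem InE_E {P : Params} (hB : P.Balanced) : InE 3 (E P) := by
  obtain ⟨-, h2⟩ := hB
  refine ⟨fun k hk hk' => ?_, fun _ => ?_, fun h => absurd h (by norm_num)⟩
  · have : k = 2 := by omega
    subst this; simp [hE]
  · simp [hE]; omega

include hE in
/-- The eight Rhin–Viola parameters of `E(P)` are `P` (uses (2.2) for `m` and `r`). [cite: RhinViola2001, §2 (2.2), (2.7)] -/
theorem rv_of_E {P : Params} (hB : P.Balanced) :
    (⟨(E P).b 1, (E P).a 3, (E P).a 2, (E P).a 1, (E P).a 2 + (E P).b 3 - (E P).c 3, (E P).b 3,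
      (E P).b 1 + (E P).b 3 - (E P).c 3, (E P).b 2⟩ : Params) = P := by
  obtain ⟨h1, -⟩ := hB
  refine Params.ext ?_ ?_ ?_ ?_ ?_ ?_ ?_ ?_ <;> simp [hE] <;> omega

include hE in
/-- **`I(P)` is Fischler's `𝒥₃(E(P))` in `ℝ₊ ∪ {∞}`**: `Jn 3 (E P) = ∫⁻_{(0,1)³} (integrand P)⁺`. [cite: RhinViola2001, §2 (2.1)]
[cite: Fischler2002Polyzetas, §3 Théorème 3.2 (n = 3)] -/
theorem Jn_E {P : Params} (hB : P.Balanced) : Jn 3 (E P) = ∫⁻ p in cube, ENNReal.ofReal (integrand P p) := by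
  rw [Theoreme32.Jn_three_eq_lintegral_rv (E P) (by simp [hE]), rv_of_E hE hB]

include hE in
/-- Fischler's criterion at `E(P)` is `P.Nonneg` (the eight parameters). [cite: RhinViola2001, §2 p. 271 (finiteness of (2.1))]
[cite: Fischler2002Polyzetas, §3 p. 3 (critère de finitude)] -/
theorem crit_E_iff {P : Params} (hB : P.Balanced) : FinitenessCriterionGen 3 (E P) ↔ P.Nonneg := by
  rw [Theoreme32.crit3_iff (InE_E hE hB)]
  obtain ⟨h1, -⟩ := hB
  simp only [hE, if_true, show (2 : ℕ) ≠ 1 by norm_num, show (3 : ℕ) ≠ 1 by norm_num, show (3 : ℕ) ≠ 2 by norm_num, if_false,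
    Params.Nonneg]
  constructor
  · rintro ⟨hl, hk, hj, hh, hs, hq, hm, hr⟩; exact ⟨hh, hj, hk, hl, by omega, hq, by omega, hs⟩
  · rintro ⟨hh, hj, hk, hl, hm, hq, hr, hs⟩; exact ⟨hl, hk, hj, hh, hs, hq, by omega, by omega⟩

include hE in
/-- Fischler's normaliser at `E(P)` is `h!j!k!l!m!q!r!s!`. [cite: RhinViola2001, §4 (4.3)] [cite: Fischler2002Polyzetas, §3 Théorème 3.2 (n = 3)] -/
theorem normaliser_E {P : Params} (hB : P.Balanced) : rvNormaliser 3 (E P) = factProd P := by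
  obtain ⟨h1, -⟩ := hB
  unfold rvNormaliser factProd
  simp only [show (3 : ℕ) ≠ 2 by norm_num, if_false, if_true, hE, show (2 : ℕ) ≠ 1 by norm_num, show (3 : ℕ) ≠ 1 by norm_num]
  rw [show P.k + P.q - (P.q + P.h - P.r) = P.m by omega, show P.h + P.q - (P.q + P.h - P.r) = P.r by omega]
  ring

/-! ### `I(P)` as a real number: the Bochner integral is the lower integral (the integrand is `≥ 0` on the cube) -/

/-- The integrand (2.1) is continuous on the open cube. [cite: RhinViola2001, §2 (2.1)] -/
private theorem continuousOn_integrand (P : Params) : ContinuousOn (integrand P) cube := by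
  have h0 : ContinuousOn (fun p : Fin 3 → ℝ => p 0) cube := (continuous_apply 0).continuousOn
  have h1 : ContinuousOn (fun p : Fin 3 → ℝ => p 1) cube := (continuous_apply 1).continuousOn
  have h2 : ContinuousOn (fun p : Fin 3 → ℝ => p 2) cube := (continuous_apply 2).continuousOn
  have hD : ∀ p ∈ cube, (1 - (1 - p 0 * p 1) * p 2) ≠ 0 := fun p hp =>
    (ThetaInvariance.aux_D (hp 0).1 (hp 0).2 (hp 1).1 (hp 1).2 (hp 2).1 (hp 2).2).1.ne'
  unfold integrand
  refine ContinuousOn.div ?_ (((continuousOn_const.sub ((continuousOn_const.sub (h0.mul h1)).mul h2)).zpow₀ _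
    fun p hp => Or.inl (hD p hp))) fun p hp => zpow_ne_zero _ (hD p hp)
  refine ((((((h0.zpow₀ _ fun p hp => Or.inl (hp 0).1.ne').mul ((continuousOn_const.sub h0).zpow₀ _ fun p hp =>
    Or.inl (by have := (hp 0).2; intro h; simp only [Pi.sub_apply] at h; linarith))).mul (h1.zpow₀ _ fun p hp => Or.inl (hp 1).1.ne')).mul
    ((continuousOn_const.sub h1).zpow₀ _ fun p hp => Or.inl (by have := (hp 1).2; intro h; simp only [Pi.sub_apply] at h; linarith))).mul
    (h2.zpow₀ _ fun p hp => Or.inl (hp 2).1.ne')).mul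
    ((continuousOn_const.sub h2).zpow₀ _ fun p hp => Or.inl (by have := (hp 2).2; intro h; simp only [Pi.sub_apply] at h; linarith)))

/-- The integrand (2.1) is non-negative on the open cube. [cite: RhinViola2001, §2 (2.1)] -/
private theorem integrand_nonneg (P : Params) {p : Fin 3 → ℝ} (hp : p ∈ cube) : 0 ≤ integrand P p := by
  have h0 := hp 0; have h1 := hp 1; have h2 := hp 2
  have hD := (ThetaInvariance.aux_D h0.1 h0.2 h1.1 h1.2 h2.1 h2.2).1
  unfold integrand
  refine div_nonneg ?_ (zpow_nonneg hD.le _)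
  have := h0.2; have := h1.2; have := h2.2
  exact mul_nonneg (mul_nonneg (mul_nonneg (mul_nonneg (mul_nonneg (zpow_nonneg h0.1.le _) (zpow_nonneg (by linarith) _))
    (zpow_nonneg h1.1.le _)) (zpow_nonneg (by linarith) _)) (zpow_nonneg h2.1.le _)) (zpow_nonneg (by linarith) _)

/-- **`I(P) = (∫⁻_{(0,1)³} (integrand P)⁺).toReal`** (every `P`: the integrand is `≥ 0` on the cube). [cite: RhinViola2001, §2 (2.1)] -/
theorem I_eq_toReal_lintegral (P : Params) : I P = (∫⁻ p in cube, ENNReal.ofReal (integrand P p)).toReal := by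
  unfold I
  exact integral_eq_lintegral_of_nonneg_ae ((ae_restrict_iff' ThetaInvariance.measurableSet_cube).2
    (Filter.Eventually.of_forall fun p hp => integrand_nonneg P hp))
    ((continuousOn_integrand P).aestronglyMeasurable ThetaInvariance.measurableSet_cube)

include hE in
/-- `I(P) = (𝒥₃(E P)).toReal` for balanced `P`. [cite: RhinViola2001, §2 (2.1)] [cite: Fischler2002Polyzetas, §3 Théorème 3.2 (n = 3)] -/
theorem I_eq_toReal_Jn {P : Params} (hB : P.Balanced) : I P = (Jn 3 (E P)).toReal := by
  rw [I_eq_toReal_lintegral, Jn_E hE hB]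

/-! ### Rhin–Viola's generators as elements of Fischler's group, on the live coordinates -/

section Gens

variable {gσ gψ gφ : Equiv.Perm {p : Exponents // InE 3 p}}

/-- `σ` (RV) is `σ` (Fischler): live coordinates. [cite: RhinViola2001, §2 p. 272 (σ)] [cite: Fischler2002Polyzetas, §3 p. 3 (σ)] -/
theorem live_sigma (hσ : ∀ p, (gσ p).1 = Fischler2002.sigma p.1) (q : {p : Exponents // InE 3 p}) (Q : Params) (hQ : Q.Balanced)
    (h : q.1.a 1 = Q.l ∧ q.1.a 2 = Q.k ∧ q.1.a 3 = Q.j ∧ q.1.b 1 = Q.h ∧ q.1.b 2 = Q.s ∧ q.1.b 3 = Q.q ∧ q.1.c 3 = Q.q + Q.h - Q.r) :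
    (gσ q).1.a 1 = (sigma Q).l ∧ (gσ q).1.a 2 = (sigma Q).k ∧ (gσ q).1.a 3 = (sigma Q).j ∧ (gσ q).1.b 1 = (sigma Q).h ∧
      (gσ q).1.b 2 = (sigma Q).s ∧ (gσ q).1.b 3 = (sigma Q).q ∧ (gσ q).1.c 3 = (sigma Q).q + (sigma Q).h - (sigma Q).r := by
  obtain ⟨h1, -⟩ := hQ
  obtain ⟨e1, e2, e3, e4, e5, e6, e7⟩ := h
  rw [hσ q]
  simp only [Fischler2002.sigma, sigma, if_true, show (2 : ℕ) ≠ 1 by norm_num, show (3 : ℕ) ≠ 1 by norm_num,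
    show (3 : ℕ) ≠ 2 by norm_num, if_false]
  refine ⟨e5, e4, e3, e2, e1, e6, ?_⟩
  rw [e7]; omega

/-- `ϕ` (RV, Euler in `x`) is `σφσ` (Fischler): live coordinates. [cite: RhinViola2001, §4 (4.1) (ϕ)] [cite: Fischler2002Polyzetas, §3 p. 4 (φ)] -/
theorem live_phi (hσ : ∀ p, (gσ p).1 = Fischler2002.sigma p.1) (hφ : ∀ p, (gφ p).1 = Fischler2002.phi 3 p.1)
    (q : {p : Exponents // InE 3 p}) (Q : Params) (hQ : Q.Balanced)
    (h : q.1.a 1 = Q.l ∧ q.1.a 2 = Q.k ∧ q.1.a 3 = Q.j ∧ q.1.b 1 = Q.h ∧ q.1.b 2 = Q.s ∧ q.1.b 3 = Q.q ∧ q.1.c 3 = Q.q + Q.h - Q.r) :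
    ((gσ * gφ * gσ) q).1.a 1 = (phi Q).l ∧ ((gσ * gφ * gσ) q).1.a 2 = (phi Q).k ∧ ((gσ * gφ * gσ) q).1.a 3 = (phi Q).j ∧
      ((gσ * gφ * gσ) q).1.b 1 = (phi Q).h ∧ ((gσ * gφ * gσ) q).1.b 2 = (phi Q).s ∧ ((gσ * gφ * gσ) q).1.b 3 = (phi Q).q ∧
      ((gσ * gφ * gσ) q).1.c 3 = (phi Q).q + (phi Q).h - (phi Q).r := by
  obtain ⟨h1, h2⟩ := hQ
  obtain ⟨e1, e2, e3, e4, e5, e6, e7⟩ := h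
  simp only [Equiv.Perm.mul_apply]
  rw [hσ, hφ, hσ q]
  simp only [Fischler2002.sigma, Fischler2002.phi, phi, Params.aux, if_true, show (2 : ℕ) ≠ 1 by norm_num,
    show (3 : ℕ) ≠ 1 by norm_num, show (3 : ℕ) ≠ 2 by norm_num, show (3 - 1 : ℕ) = 2 from rfl, show (1 : ℕ) ≠ 2 by norm_num,
    show (2 : ℕ) ≠ 3 by norm_num, if_false]
  refine ⟨by rw [e1, e4, e7]; omega, e2, e3, e7, e5, by rw [e4, e6, e7]; omega, by rw [e4]; omega⟩

/-- `χ` (RV, Euler in `z`) is the word `χ₃ = ψφσφσφσψ` (Fischler): live coordinates. [cite: RhinViola2001, §4 p. 281 (χ)]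
[cite: Fischler2002Polyzetas, §3 p. 3 (χ)] -/
theorem live_chi (hσ : ∀ p, (gσ p).1 = Fischler2002.sigma p.1) (hψ : ∀ p, (gψ p).1 = Fischler2002.psi 3 p.1)
    (hφ : ∀ p, (gφ p).1 = Fischler2002.phi 3 p.1) (q : {p : Exponents // InE 3 p}) (Q : Params) (hQ : Q.Balanced)
    (h : q.1.a 1 = Q.l ∧ q.1.a 2 = Q.k ∧ q.1.a 3 = Q.j ∧ q.1.b 1 = Q.h ∧ q.1.b 2 = Q.s ∧ q.1.b 3 = Q.q ∧ q.1.c 3 = Q.q + Q.h - Q.r) :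
    ((gψ * gφ * gσ * gφ * gσ * gφ * gσ * gψ) q).1.a 1 = (chi Q).l ∧ ((gψ * gφ * gσ * gφ * gσ * gφ * gσ * gψ) q).1.a 2 = (chi Q).k ∧
      ((gψ * gφ * gσ * gφ * gσ * gφ * gσ * gψ) q).1.a 3 = (chi Q).j ∧ ((gψ * gφ * gσ * gφ * gσ * gφ * gσ * gψ) q).1.b 1 = (chi Q).h ∧
      ((gψ * gφ * gσ * gφ * gσ * gφ * gσ * gψ) q).1.b 2 = (chi Q).s ∧ ((gψ * gφ * gσ * gφ * gσ * gφ * gσ * gψ) q).1.b 3 = (chi Q).q ∧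
      ((gψ * gφ * gσ * gφ * gσ * gφ * gσ * gψ) q).1.c 3 = (chi Q).q + (chi Q).h - (chi Q).r := by
  obtain ⟨h1, h2⟩ := hQ
  obtain ⟨e1, e2, e3, e4, e5, e6, e7⟩ := h
  obtain ⟨f1, f2, f3, f4, f5, f6, f7⟩ := Theoreme32.chiWord_coords (F := fun c p =>
    ![p.b 1, 0, 0, p.b 2, 0, p.a 2 + p.b 2 - p.c 3, p.a 3, 0, 0, p.a 2 + p.b 3 - p.a 1, p.c 3, 0, p.a 2, 0, 0,
      p.a 2 + p.b 2 - p.b 1, 0, p.b 1 + p.b 3 - p.c 3, p.a 1 + p.b 1 - p.a 2, 0, p.a 1 + p.b 1 - p.c 3, 0, 0,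
      p.a 3 + p.b 3 - p.c 3, p.a 1 + p.b 1 - p.a 3, 0, 0, p.b 3, 0, p.a 2 + p.b 3 - p.c 3, p.a 1, 0] c)
    (A := fun s t c => Fin.ofNat 32
      ((if (Nat.testBit c.val (s.symm 0).val != Nat.testBit t.val 0) then 1 else 0) +
        (if (Nat.testBit c.val (s.symm 1).val != Nat.testBit t.val 1) then 2 else 0) +
        (if (Nat.testBit c.val (s.symm 2).val != Nat.testBit t.val 2) then 4 else 0) +
        (if (Nat.testBit c.val (s.symm 3).val != Nat.testBit t.val 3) then 8 else 0) +
        (if (Nat.testBit c.val (s.symm 4).val != Nat.testBit t.val 4) then 16 else 0)))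
    (fun _ _ => rfl) (fun _ _ _ => rfl) hσ hψ hφ q
  rw [f1, f2, f3, f4, f5, f6, f7, e1, e2, e3, e4, e5, e6, e7]
  simp only [chi, Params.aux]
  refine ⟨?_, ?_, ?_, ?_, ?_, ?_, ?_⟩ <;> first | trivial | omega

/-- `ϑ` (RV) is the word `ϑ̃ = φσφσψσφσφσψσφ` (Fischler): live coordinates. [cite: RhinViola2001, §2 p. 272 (ϑ = (h j k l m q r s))]
[cite: Fischler2002Polyzetas, §3 Théorème 3.2 (n = 3)] -/
theorem live_theta (hσ : ∀ p, (gσ p).1 = Fischler2002.sigma p.1) (hψ : ∀ p, (gψ p).1 = Fischler2002.psi 3 p.1)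
    (hφ : ∀ p, (gφ p).1 = Fischler2002.phi 3 p.1) (q : {p : Exponents // InE 3 p}) (Q : Params) (hQ : Q.Balanced)
    (h : q.1.a 1 = Q.l ∧ q.1.a 2 = Q.k ∧ q.1.a 3 = Q.j ∧ q.1.b 1 = Q.h ∧ q.1.b 2 = Q.s ∧ q.1.b 3 = Q.q ∧ q.1.c 3 = Q.q + Q.h - Q.r) :
    ((gφ * gσ * gφ * gσ * gψ * gσ * gφ * gσ * gφ * gσ * gψ * gσ * gφ) q).1.a 1 = (theta Q).l ∧
      ((gφ * gσ * gφ * gσ * gψ * gσ * gφ * gσ * gφ * gσ * gψ * gσ * gφ) q).1.a 2 = (theta Q).k ∧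
      ((gφ * gσ * gφ * gσ * gψ * gσ * gφ * gσ * gφ * gσ * gψ * gσ * gφ) q).1.a 3 = (theta Q).j ∧
      ((gφ * gσ * gφ * gσ * gψ * gσ * gφ * gσ * gφ * gσ * gψ * gσ * gφ) q).1.b 1 = (theta Q).h ∧
      ((gφ * gσ * gφ * gσ * gψ * gσ * gφ * gσ * gφ * gσ * gψ * gσ * gφ) q).1.b 2 = (theta Q).s ∧
      ((gφ * gσ * gφ * gσ * gψ * gσ * gφ * gσ * gφ * gσ * gψ * gσ * gφ) q).1.b 3 = (theta Q).q ∧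
      ((gφ * gσ * gφ * gσ * gψ * gσ * gφ * gσ * gφ * gσ * gψ * gσ * gφ) q).1.c 3 = (theta Q).q + (theta Q).h - (theta Q).r := by
  obtain ⟨h1, h2⟩ := hQ
  obtain ⟨e1, e2, e3, e4, e5, e6, e7⟩ := h
  obtain ⟨f1, f2, f3, f4, f5, f6, f7⟩ := Theoreme32.thetaWord_coords (F := fun c p =>
    ![p.b 1, 0, 0, p.b 2, 0, p.a 2 + p.b 2 - p.c 3, p.a 3, 0, 0, p.a 2 + p.b 3 - p.a 1, p.c 3, 0, p.a 2, 0, 0,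
      p.a 2 + p.b 2 - p.b 1, 0, p.b 1 + p.b 3 - p.c 3, p.a 1 + p.b 1 - p.a 2, 0, p.a 1 + p.b 1 - p.c 3, 0, 0,
      p.a 3 + p.b 3 - p.c 3, p.a 1 + p.b 1 - p.a 3, 0, 0, p.b 3, 0, p.a 2 + p.b 3 - p.c 3, p.a 1, 0] c)
    (A := fun s t c => Fin.ofNat 32
      ((if (Nat.testBit c.val (s.symm 0).val != Nat.testBit t.val 0) then 1 else 0) +
        (if (Nat.testBit c.val (s.symm 1).val != Nat.testBit t.val 1) then 2 else 0) +
        (if (Nat.testBit c.val (s.symm 2).val != Nat.testBit t.val 2) then 4 else 0) +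
        (if (Nat.testBit c.val (s.symm 3).val != Nat.testBit t.val 3) then 8 else 0) +
        (if (Nat.testBit c.val (s.symm 4).val != Nat.testBit t.val 4) then 16 else 0)))
    (fun _ _ => rfl) (fun _ _ _ => rfl) hσ hψ hφ q
  rw [f1, f2, f3, f4, f5, f6, f7, e1, e2, e3, e4, e5, e6, e7]
  simp only [theta]
  refine ⟨?_, ?_, ?_, ?_, ?_, ?_, ?_⟩ <;> first | trivial | omega

/-- **Every word in Rhin–Viola's generators is realised in Fischler's group on the live coordinates**: for balanced `Q` and a point `q`
of `𝓔₃` with the live coordinates of `E(Q)`, there is `g ∈ ⟨σ',ψ',φ'⟩` with `g·q` having the live coordinates of `E(ϱ Q)`.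
[cite: RhinViola2001, §4 (4.4) (words ϱ in ϕ, χ, ϑ, σ)] [cite: Fischler2002Polyzetas, §3 Théorème 3.2 (n = 3)] -/
theorem exists_word_elem (hσ : ∀ p, (gσ p).1 = Fischler2002.sigma p.1) (hψ : ∀ p, (gψ p).1 = Fischler2002.psi 3 p.1)
    (hφ : ∀ p, (gφ p).1 = Fischler2002.phi 3 p.1) (w : List Gen) (q : {p : Exponents // InE 3 p}) (Q : Params)
    (hQ : Q.Balanced)
    (h : q.1.a 1 = Q.l ∧ q.1.a 2 = Q.k ∧ q.1.a 3 = Q.j ∧ q.1.b 1 = Q.h ∧ q.1.b 2 = Q.s ∧ q.1.b 3 = Q.q ∧ q.1.c 3 = Q.q + Q.h - Q.r) :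
    (act w Q).Balanced ∧ ∃ g ∈ Subgroup.closure ({gσ, gψ, gφ} : Set (Equiv.Perm {p : Exponents // InE 3 p})),
      (g q).1.a 1 = (act w Q).l ∧ (g q).1.a 2 = (act w Q).k ∧ (g q).1.a 3 = (act w Q).j ∧ (g q).1.b 1 = (act w Q).h ∧
      (g q).1.b 2 = (act w Q).s ∧ (g q).1.b 3 = (act w Q).q ∧ (g q).1.c 3 = (act w Q).q + (act w Q).h - (act w Q).r := by
  have mS : gσ ∈ Subgroup.closure ({gσ, gψ, gφ} : Set (Equiv.Perm {p : Exponents // InE 3 p})) :=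
    Subgroup.subset_closure (by simp)
  have mP : gψ ∈ Subgroup.closure ({gσ, gψ, gφ} : Set (Equiv.Perm {p : Exponents // InE 3 p})) :=
    Subgroup.subset_closure (by simp)
  have mΦ : gφ ∈ Subgroup.closure ({gσ, gψ, gφ} : Set (Equiv.Perm {p : Exponents // InE 3 p})) :=
    Subgroup.subset_closure (by simp)
  induction w with
  | nil => exact ⟨hQ, 1, Subgroup.one_mem _, h⟩
  | cons γ w ih =>
    obtain ⟨hB, g, hg, hlive⟩ := ih
    have hact : act (γ :: w) Q = γ.act (act w Q) := rfl
    rw [hact]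
    cases γ with
    | Phi =>
      exact ⟨balanced_phi hB, gσ * gφ * gσ * g, mul_mem (mul_mem (mul_mem mS mΦ) mS) hg,
        by rw [Equiv.Perm.mul_apply]; exact live_phi hσ hφ (g q) _ hB hlive⟩
    | Chi =>
      exact ⟨balanced_chi hB, gψ * gφ * gσ * gφ * gσ * gφ * gσ * gψ * g,
        mul_mem (mul_mem (mul_mem (mul_mem (mul_mem (mul_mem (mul_mem (mul_mem mP mΦ) mS) mΦ) mS) mΦ) mS) mP) hg,
        by rw [Equiv.Perm.mul_apply]; exact live_chi hσ hψ hφ (g q) _ hB hlive⟩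
    | Theta =>
      exact ⟨balanced_theta hB, gφ * gσ * gφ * gσ * gψ * gσ * gφ * gσ * gφ * gσ * gψ * gσ * gφ * g,
        mul_mem (mul_mem (mul_mem (mul_mem (mul_mem (mul_mem (mul_mem (mul_mem (mul_mem (mul_mem (mul_mem (mul_mem (mul_mem
          mΦ mS) mΦ) mS) mP) mS) mΦ) mS) mΦ) mS) mP) mS) mΦ) hg,
        by rw [Equiv.Perm.mul_apply]; exact live_theta hσ hψ hφ (g q) _ hB hlive⟩
    | Sigma =>
      exact ⟨balanced_sigma hB, gσ * g, mul_mem mS hg, by rw [Equiv.Perm.mul_apply]; exact live_sigma hσ (g q) _ hB hlive⟩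

end Gens

/-! ### The transformation formula with eight signs -/

include hE in
/-- **Rhin–Viola's (4.4) with EIGHT signs, in `ℝ₊ ∪ {∞}`**: for balanced `P` and any word `ϱ` with the eight parameters of `P` and of
`ϱP` non-negative, `𝒥₃(E(ϱP))/(ϱ(h)!⋯ϱ(s)!) = 𝒥₃(E P)/(h!⋯s!)`. [cite: RhinViola2001, §4 (4.4)] [cite: Fischler2002Polyzetas, §3 Théorème 3.2 (n = 3)] -/
theorem Jn_div_act_of_nonneg (w : List Gen) {P : Params} (hB : P.Balanced) (hP : P.Nonneg) (hw : (act w P).Nonneg) :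
    Jn 3 (E (act w P)) / (factProd (act w P) : ℝ≥0∞) = Jn 3 (E P) / (factProd P : ℝ≥0∞) := by
  obtain ⟨gσ, gψ, gφ, hσ, hψ, hφ⟩ := Theoreme32.exists_perms (n := 3) (by norm_num)
  have hlive : (E P).a 1 = P.l ∧ (E P).a 2 = P.k ∧ (E P).a 3 = P.j ∧ (E P).b 1 = P.h ∧ (E P).b 2 = P.s ∧ (E P).b 3 = P.q ∧
      (E P).c 3 = P.q + P.h - P.r := by simp [hE]
  obtain ⟨hBw, g, hg, l1, l2, l3, l4, l5, l6, l7⟩ := exists_word_elem hσ hψ hφ w ⟨E P, InE_E hE hB⟩ P hB hlive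
  -- the live coordinates of `g · E(P)` are those of `E(ϱ P)`
  have ha : ∀ k, 1 ≤ k → k ≤ 3 → (g ⟨E P, InE_E hE hB⟩).1.a k = (E (act w P)).a k := by
    intro k hk hk'
    interval_cases k
    · rw [l1]; simp [hE]
    · rw [l2]; simp [hE]
    · rw [l3]; simp [hE]
  have hb : ∀ k, 1 ≤ k → k ≤ 3 → (g ⟨E P, InE_E hE hB⟩).1.b k = (E (act w P)).b k := by
    intro k hk hk'
    interval_cases k
    · rw [l4]; simp [hE]
    · rw [l5]; simp [hE]
    · rw [l6]; simp [hE]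
  have hc : ∀ k, 2 ≤ k → k ≤ 3 → (g ⟨E P, InE_E hE hB⟩).1.c k = (E (act w P)).c k := by
    intro k hk hk'
    interval_cases k
    · rw [(g ⟨E P, InE_E hE hB⟩).2.1 2 le_rfl (by norm_num), (InE_E hE hBw).1 2 le_rfl (by norm_num)]
    · rw [l7]; simp [hE]
  have hcrit : FinitenessCriterionGen 3 (E P) := (crit_E_iff hE hB).2 hP
  have hcritg : FinitenessCriterionGen 3 (g ⟨E P, InE_E hE hB⟩).1 :=
    (Theoreme32.crit3_congr (g ⟨E P, InE_E hE hB⟩).2 (InE_E hE hBw) ha hb (hc 3 (by norm_num) le_rfl)).2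
      ((crit_E_iff hE hBw).2 hw)
  have hinv := Theoreme32.invariance_three hσ hψ hφ hg ⟨E P, InE_E hE hB⟩ hcrit hcritg
  rw [Theoreme32.Jn_three_congr ha hb hc, Theoreme32.normaliser_three_congr ha hb (hc 3 (by norm_num) le_rfl),
    normaliser_E hE hBw] at hinv
  rw [hinv]
  exact congrArg _ (by rw [normaliser_E hE hB])

end Eight

/-- **Rhin–Viola's transformation formula (4.4) under EIGHT signs, not sixteen**: for every word `ϱ` in `ϕ, χ, ϑ, σ` and every
balanced `P` (`h+m = k+r`, `j+q = l+s`) whose eight parameters AND whose image's eight parameters are non-negative — the integers (2.8) of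
`P`, of `ϱP` and everything in between being free in sign —, `I(ϱP)/(ϱ(h)!⋯ϱ(s)!) = I(P)/(h!⋯s!)`. The tree's `normI_act_holds` assumes all
sixteen integers `≥ 0` (RV's standing assumption of §4); this is Fischler's Théorème 3.2 (`n = 3`) read through the dictionary
`𝒥₃|𝓔₃ = I`. [cite: RhinViola2001, §4 (4.4), p. 280] [cite: Fischler2002Polyzetas, §3 Théorème 3.2 (n = 3)] -/
theorem normI_act_of_nonneg (w : List Gen) {P : Params} (hB : P.Balanced) (hP : P.Nonneg) (hw : (act w P).Nonneg) :
    normI (act w P) = normI P := by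
  have hE : ∀ Q : Params, (fun Q : Params => (⟨fun k => if k = 1 then Q.l else if k = 2 then Q.k else if k = 3 then Q.j else 0,
      fun k => if k = 1 then Q.h else if k = 2 then Q.s else if k = 3 then Q.q else 0,
      fun k => if k = 3 then Q.q + Q.h - Q.r else 0⟩ : Exponents)) Q =
      ⟨fun k => if k = 1 then Q.l else if k = 2 then Q.k else if k = 3 then Q.j else 0,
        fun k => if k = 1 then Q.h else if k = 2 then Q.s else if k = 3 then Q.q else 0,
        fun k => if k = 3 then Q.q + Q.h - Q.r else 0⟩ := fun _ => rfl
  have hBw : (act w P).Balanced := LevelFour.balanced_act w hB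
  have key := Jn_div_act_of_nonneg hE w hB hP hw
  have hfin := (Jn_finite_iff_holds 3 _ (by norm_num)).2 ((crit_E_iff hE hB).2 hP)
  have hfinw := (Jn_finite_iff_holds 3 _ (by norm_num)).2 ((crit_E_iff hE hBw).2 hw)
  unfold normI
  rw [I_eq_toReal_Jn hE hB, I_eq_toReal_Jn hE hBw]
  have h1 := congrArg ENNReal.toReal key
  rw [ENNReal.toReal_div, ENNReal.toReal_div, ENNReal.toReal_natCast, ENNReal.toReal_natCast] at h1
  exact h1

end Literature.NumberTheory.Irrationality.RhinViola2001

end
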